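import Literature.AlgebraicGeometry.HodgeTheory.AlgebraicityLocusFromInputs
import Literature.AlgebraicGeometry.HodgeTheory.AlgebraicityLocusLinearSections
import HarnessLib

/-!
# Algebraicity loci: the structure theorem from Mumford's curve lemma and Verdier's triviality

Topic `Literature/AlgebraicGeometry/HodgeTheory` (family `hodge`): the named fact
`charlesSchnell_algebraicityLocus_iUnion_closed` (`AlgebraicityLocus.lean`; Charles–Schnell,
*Notes on absolute Hodge classes*, proof of Prop. 11.3.11; Voisin, *Hodge Theory II*, §3.3.1,
§7.3.2) PROVED FROM TWO INPUTS — Mumford's curve lemma (the tree's named fact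
`Motives.mumford_smoothCurve_through_two_points`) and Verdier's generic topological triviality of
pairs (Verdier 1976, Cor. 5.1) for the hyperplane witness families — by
`charlesSchnell_algebraicityLocus_iUnion_closed_of_mumford_of_verdier`. This improves
`charlesSchnell_algebraicityLocus_iUnion_closed_of_inputs` (`AlgebraicityLocusFromInputs`) by
proving its third input (`codim_dichotomy_of_isPreimmersion`, `AlgebraicityLocusLinearSections`).

## References

* [CharlesSchnell2014Notes] F. Charles, C. Schnell, Notes on absolute Hodge classes, in Hodge
  Theory (Princeton Math. Notes 49, 2014), Prop. 11.3.11 (proof).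
* [VoisinHodgeII2003] C. Voisin, Hodge Theory and Complex Algebraic Geometry II (2003), §3.3.1,
  §7.3.2 (proof of Thm. 7.19).
* [Verdier1976] J.-L. Verdier, Stratifications de Whitney et théorème de Bertini–Sard, Invent.
  Math. 36 (1976), Cor. 5.1.
* [MumfordAV1970] D. Mumford, Abelian Varieties (1970), §6, Lemma.
* [Hartshorne1977] R. Hartshorne, Algebraic Geometry (1977), I Thm. 7.2.
-/

noncomputable section

open CategoryTheory AlgebraicGeometry Limits Set Order MonoidalCategory CartesianMonoidalCategory
open _root_.Topology TopologicalSpace Filter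
open Literature.AlgebraicGeometry.Motives Literature.AlgebraicGeometry.Motives.ProjectiveSpace

namespace Literature.AlgebraicGeometry.HodgeTheory

section HodgeTheory

/-- **The structure theorem on algebraicity loci from Mumford's curve lemma and Verdier's
generic triviality of pairs.** The named fact `charlesSchnell_algebraicityLocus_iUnion_closed`
(Charles–Schnell 2014, proof of Prop. 11.3.11; Voisin, *Hodge Theory II*, §3.3.1 and §7.3.2: for
a smooth projective family `f : 𝒳 ⟶ S` of relative dimension `n` over a smooth quasi-projective
base with `𝒳` quasi-projective and `A ∈ H²ᵖ(𝒳(ℂ); ℂ)`, the algebraicity locus of `A` is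
`⋃_j W_j(ℂ)` for countably many Zariski-closed `W_j ⊆ S`) follows from TWO inputs:

* `hM` — two points of an irreducible variety lie on an irreducible curve (Mumford, *Abelian
  Varieties*, §6 Lemma; the tree's named fact `Motives.mumford_smoothCurve_through_two_points`);
* `hV` — for the hyperplane witness families `hyperplaneFamily f ε d m` built from a preimmersion
  `ε : 𝒳 ⟶ ℙᴺ` (parameters `((ℙ^{N_d})^*)^m × S`, supports the tuples of hypersurface sections of
  degree `d + 1` of the fibres) and every irreducible closed `Y` in the parameter space: a non-empty
  open part `Y ∩ O` over every smaller open part of which the pair (`𝒳 ×_S T`, `𝒵`) is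
  topologically locally trivial over path connected relative neighbourhoods of the complex points
  (J.-L. Verdier, Invent. Math. 36 (1976), Cor. 5.1, for the proper morphism `𝒳 ×_S Y → Y` and
  the closed subset `𝒵_Y`, with the local path-connectedness of complex analytic sets).

Compared with `charlesSchnell_algebraicityLocus_iUnion_closed_of_inputs`, the third input (generic
uniformity of the codimension condition, Chevalley) is now PROVED
(`codim_dichotomy_of_isPreimmersion`, `AlgebraicityLocusLinearSections`: the projective dimension
theorem in the projective fibres and properness of `𝒳 ×_S T → T`), and `hV` is only required for
preimmersions `ε`. Everything else — strong closedness of the good sets, limits along curves, the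
boundary step, the dichotomy from pair triviality, the Noetherian-induction assembly over proper
parameter spaces, the completeness of the hyperplane witnesses — is proved in the tree.
[cite: CharlesSchnell2014Notes, Prop. 11.3.11 (proof)] [cite: VoisinHodgeII2003, §3.3.1 and §7.3.2]
[cite: Verdier1976, Cor. 5.1] [cite: MumfordAV1970, §6, Lemma] [cite: Hartshorne1977, I Thm. 7.2] -/
theorem charlesSchnell_algebraicityLocus_iUnion_closed_of_mumford_of_verdier
    (hM : Motives.mumford_smoothCurve_through_two_points)
    (hV : ∀ ⦃𝒳 S : Motives.SchemeOver ℂ⦄ (f : 𝒳 ⟶ S) (n : ℕ), IsQuasiProjectiveOver 𝒳 →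
      IsQuasiProjectiveOver S → Smooth S.hom → Motives.IsSmoothProjectiveFamily f n →
      ∀ ⦃N : ℕ⦄ (ε : 𝒳 ⟶ projectiveSpace N ℂ), IsPreimmersion ε.left → ∀ (d m : ℕ)
        (Y : Set (hyperplaneFamily f ε d m).T.left), IsClosed Y → IsIrreducible Y →
      ∃ O : (hyperplaneFamily f ε d m).T.left.Opens,
        (Y ∩ (O : Set (hyperplaneFamily f ε d m).T.left)).Nonempty ∧
        ∀ O' : (hyperplaneFamily f ε d m).T.left.Opens, O' ≤ O →
          ∀ y₀ : Motives.ComplexPoints (hyperplaneFamily f ε d m).T,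
            y₀.pt ∈ Y ∧ y₀.pt ∈ (O' : Set (hyperplaneFamily f ε d m).T.left) →
          ∃ V : Set (Motives.ComplexPoints (hyperplaneFamily f ε d m).T),
            V ⊆ {y | y.pt ∈ Y ∧ y.pt ∈ (O' : Set (hyperplaneFamily f ε d m).T.left)} ∧
            V ∈ 𝓝[{y | y.pt ∈ Y ∧ y.pt ∈ (O' : Set (hyperplaneFamily f ε d m).T.left)}] y₀ ∧
            IsPathConnected V ∧
            ∃ (F₀ : Type) (_ : TopologicalSpace F₀) (C₀ : Set F₀)
              (φ : ↥V × F₀ ≃ₜ {q : ↥V × Motives.ComplexPoints 𝒳 //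
                AlgPoints.map f q.2 = AlgPoints.map (hyperplaneFamily f ε d m).h q.1.1}),
              (∀ x, (φ x).1.1 = x.1) ∧
              (∀ x, (AlgPoints.prodEquiv.symm ((φ x).1.2,
                  ((φ x).1.1 : Motives.ComplexPoints (hyperplaneFamily f ε d m).T)) :
                    Motives.ComplexPoints (𝒳 ⊗ (hyperplaneFamily f ε d m).T)).pt ∈
                  (hyperplaneFamily f ε d m).𝒵 ↔ x.2 ∈ C₀)) :
    charlesSchnell_algebraicityLocus_iUnion_closed := by
  intro 𝒳 S f n p h𝒳 hS hSsm hfam A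
  -- the standing instances
  haveI : Smooth S.hom := hSsm
  haveI : IsProper f.left := hfam.isProper
  obtain ⟨P', j', hP', hj'⟩ := hS
  haveI : IsProper P'.hom := hP'.isProper
  haveI : IsSeparated S.hom := by
    rw [show S.hom = j'.left ≫ P'.hom from (Over.w j').symm]
    infer_instance
  have hS : IsQuasiProjectiveOver S := ⟨P', j', hP', hj'⟩
  haveI : IsSeparated 𝒳.hom := by
    rw [show 𝒳.hom = f.left ≫ S.hom from (Over.w f).symm]
    infer_instance
  -- the embedding `ε : 𝒳 ⟶ ℙᴺ` (open immersion into a projective scheme, then its embedding)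
  obtain ⟨P, j, hP, hj⟩ := h𝒳
  obtain ⟨N, ι, hι⟩ := hP
  haveI := hj
  haveI := hι
  have h𝒳 : IsQuasiProjectiveOver 𝒳 := ⟨P, j, ⟨N, ι, hι⟩, hj⟩
  set ε : 𝒳 ⟶ projectiveSpace N ℂ := j ≫ ι with hεdef
  have hε : IsEmbedding ε.left.base := by
    rw [hεdef, Over.comp_left, Scheme.Hom.comp_base, TopCat.coe_comp]
    exact ι.left.isClosedEmbedding.isEmbedding.comp j.left.isOpenEmbedding.isEmbedding
  haveI hεpre : IsPreimmersion ε.left := by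
    rw [hεdef, Over.comp_left]
    infer_instance
  -- the witness families, indexed by `(d, m)`
  let H : ℕ × ℕ → Motives.SchemeOver ℂ := fun i => (hyperplaneFamily f ε i.1 i.2).T
  let h : ∀ i, H i ⟶ S := fun i => (hyperplaneFamily f ε i.1 i.2).h
  let 𝒵 : ∀ i, Set (𝒳 ⊗ H i).left := fun i => (hyperplaneFamily f ε i.1 i.2).𝒵
  haveI : ∀ i, IsProper (h i).left := fun i => isProper_hyperplaneFamily_h f ε i.1 i.2
  haveI hlft : ∀ i, LocallyOfFiniteType (H i).hom := fun i => by
    rw [← Over.w (h i)]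
    infer_instance
  -- the good sets: codimension `≥ p` slices off which `A` dies
  let Good : ∀ i, Set (Motives.ComplexPoints (H i)) := fun i =>
    {y | (∀ x : 𝒳.left, (sliceAt 𝒳 y).left.base x ∈ 𝒵 i → height x + p ≤ (n : ℕ∞)) ∧
      complexBetti.map (Motives.fiberι f (AlgPoints.map (h i) y)) (2 * p) A ∈
        LinearMap.ker (complexBetti.restrictCompl (Motives.fiberOver f (AlgPoints.map (h i) y))
          ((lift (Motives.fiberι f (AlgPoints.map (h i) y))
            (Motives.fiberOverToSpec f (AlgPoints.map (h i) y) ≫ y)).left.base ⁻¹' 𝒵 i)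
              (2 * p)).hom}
  refine algebraicityLocus_eq_iUnion_of_dichotomy f hM hfam hS hSsm p A H h 𝒵
    (fun i => isClosed_hyperplaneFamily_𝒵 f ε i.1 i.2) Good (fun i y hy => hy) ?_ ?_
  · -- completeness of the witnesses
    intro t ht
    obtain ⟨Z, hZc, hZp, hZ0⟩ := mem_supportedClasses_iff_exists.1 ht
    obtain ⟨d, m, y, hyt, hZy⟩ := exists_tuplePoint_forall_mem_iff f ε hε t hZc
    refine ⟨(d, m), y, ?_, hyt⟩
    subst hyt
    refine ⟨fun x hx => ?_, ?_⟩
    · -- codimension: `x` lies over `h(y)`, is `ι_t z` with `z ∈ Z`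
      have hfx : f.left.base x = (AlgPoints.map (hyperplaneFamily f ε d m).h y).pt :=
        apply_eq_pt_of_sliceAt_mem_hyperplaneFamily_𝒵 f ε d m y x hx
      obtain ⟨z, rfl⟩ := exists_fiberι_base_eq f _ x hfx
      have hz : z ∈ Z := (hZy z).2 hx
      rw [height_fiberι_base_eq f _ z,
        ← le_coheight_iff_height_add_le (hfam.isSmoothProjective _) z p]
      exact hZp z hz
    · -- dies off the slice, which is `Z`
      have hslice : (lift (Motives.fiberι f (AlgPoints.map (hyperplaneFamily f ε d m).h y))
          (Motives.fiberOverToSpec f (AlgPoints.map (hyperplaneFamily f ε d m).h y) ≫ y)).left.base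
            ⁻¹' (hyperplaneFamily f ε d m).𝒵 = Z := by
        ext z
        rw [Set.mem_preimage, lift_fiberι_base_apply]
        exact (hZy z).symm
      change complexBetti.map (Motives.fiberι f (AlgPoints.map (hyperplaneFamily f ε d m).h y))
          (2 * p) A ∈
        LinearMap.ker (complexBetti.restrictCompl
          (Motives.fiberOver f (AlgPoints.map (hyperplaneFamily f ε d m).h y))
          ((lift (Motives.fiberι f (AlgPoints.map (hyperplaneFamily f ε d m).h y))
            (Motives.fiberOverToSpec f (AlgPoints.map (hyperplaneFamily f ε d m).h y) ≫
              y)).left.base ⁻¹' (hyperplaneFamily f ε d m).𝒵) (2 * p)).hom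
      rw [hslice]
      exact LinearMap.mem_ker.2 hZ0
  · -- the generic dichotomy on irreducible closed subsets of the parameter spaces
    rintro ⟨d, m⟩ Y hYc hY
    obtain ⟨OV, hYOV, hVO⟩ := hV f n h𝒳 hS hSsm hfam ε hεpre d m Y hYc hY
    haveI : LocallyOfFiniteType (hyperplaneFamily f ε d m).T.hom := hlft (d, m)
    obtain ⟨OC, hYOC, hCO⟩ := codim_dichotomy_of_isPreimmersion f (hyperplaneFamily f ε d m).h ε
      (isClosed_hyperplaneFamily_𝒵 f ε d m) (apply_eq_pt_of_sliceAt_mem_hyperplaneFamily_𝒵 f ε d m)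
      p n hY
    have hYO : (Y ∩ ((OV ⊓ OC : (hyperplaneFamily f ε d m).T.left.Opens) : Set _)).Nonempty := by
      obtain ⟨q, hqY, hq⟩ := hY.isPreirreducible _ _ OV.2 OC.2
        (by obtain ⟨q, hqY, hq⟩ := hYOV; exact ⟨q, hqY, hq⟩)
        (by obtain ⟨q, hqY, hq⟩ := hYOC; exact ⟨q, hqY, hq⟩)
      exact ⟨q, hqY, hq⟩
    refine ⟨((OV ⊓ OC : (hyperplaneFamily f ε d m).T.left.Opens) : Set _), (OV ⊓ OC).2, ?_, ?_⟩
    · obtain ⟨q, hqY, hq⟩ := hYO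
      exact ⟨q, hq, hqY⟩
    rcases hCO with hgoodC | hbadC
    · -- codimension uniform: the dichotomy for the vanishing condition (Verdier input)
      have hdich := dichotomy_of_pairTrivialisation f (hyperplaneFamily f ε d m).h
        (hyperplaneFamily f ε d m).𝒵 (2 * p) A hYc hY (OV ⊓ OC) hYO
        (hVO (OV ⊓ OC) inf_le_left)
      rcases hdich with hall | hnone
      · refine Or.inl fun y hy => ⟨hgoodC y ⟨hy.2, hy.1.2⟩, hall y ⟨hy.2, hy.1⟩⟩
      · refine Or.inr fun y hy hgood => hnone y ⟨hy.2, hy.1⟩ hgood.2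
    · exact Or.inr fun y hy hgood => hbadC y ⟨hy.2, hy.1.2⟩ hgood.1


end HodgeTheory

end Literature.AlgebraicGeometry.HodgeTheory

end
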